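/-
Copyright (c) 2026 the pub-hodgecm-mathlib formalisation cell (harness21).  Prover seat hodgecm-mathlib-LH4-p14 (g0), req620 Track A «(D-RAM) FOUR-FRAME» squad
(heir LEAD F0P3a-plan (g19); dealer LH4-plan (g10) WORD #34 (3); TARGET A of LH4-p11 (g0) 22:00:11Z, first seat of `stub_U3_stableLaw_RU`).  2026-09-03.
-/
import Literature.NumberTheory.Automorphic.UnitaryLatticeTreeDefs   -- ★ `mapGL` (the action of `GL_N(K)` on `𝒪`-lattices)
import HarnessLib

/-!
# Crux `H413`, line LH4 «(D-RAM) FOUR-FRAME» road — unit U3_Laws (iii), TIER 2 SUPPORT: «BIG-TUBE NECESSITY» — A LATTICE STABLE UNDER THE DIAGONAL TORUS ELEMENT ABSORBS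
# `(s_i − s_j)(s_i − s_k)·E_ii` (the necessary-direction complement of the tube criterion ★ `F0P3cDyRamDiagonalTubeFixed`)

Cell `hodgecm-mathlib` (D-0151), FLOOR 0, crux item H413 = `stmt-HodgeConjecture-24833`, route of record `HCCMUnconditional`; squad F0∕P3c∕LH4 (req618∕req620).  THEOREMS ONLY
(no `def`, no instance, no notation, no `sorry`, default heartbeats); lane `--supports stmt-HodgeConjecture-24833 --as helper` (count-neutral).  TARGET A of LH4-p11 (g0)'s
(S)-reduction (DATUM `F0/P3c/LH4/LH4-p11/g0/DATUM-S-RU-dltT-census.v1.LH4p11g0.md` §5), statement BY SIGNATURE as worded on the squad bus 2026-09-03T22:00:11Z.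

WHAT IS PROVED (generic valued field `K`, rank 3).  In the diagonal model of a frame (★ `F0P3cDyRamFixedCountDiagonalModel`: the frame element is `T = diag(s)` with integral
entries `|s_i| ≤ 1`, the frame projections are the coordinate idempotents `E_ii`), every lattice `M` with `diag(s)·M ≤ M` satisfies, for each slot `i` and the two other slots
`j, k`:  `(s_i − s_j)(s_i − s_k)·x_i·e_i ∈ M` for all `x ∈ M` — i.e. `M` is `(s_i − s_j)(s_i − s_k)E_ii`-stable: the FIXED vertices lie in the «big tube»
`c_i(M) ≤ v(s_i − s_j) + v(s_i − s_k)` about every splitting sub-building (TUBE ⊆ Fix ⊆ BIG TUBE; the tube `c_i ≤ v(s_i − s_j)` is the sufficient half ★ p855052).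
Because `(diag(s) − s_j·1)((diag(s) − s_k·1)·x) = ((s_l − s_j)(s_l − s_k)·x_l)_l`, which vanishes at `l = j, k` and is the claimed vector at `l = i` (`{i, j, k} = Fin 3`), while
both factors map `M` into `M` (`diag(s)·x ∈ M` by the hypothesis, `s_j·x ∈ M` as an `𝒪`-multiple).
* `diagonal_mulVec_sub_smul` — `diag(s)·x − s_j·x = ((s_l − s_j)·x_l)_l`.
* `diagonal_mulVec_sub_smul_mem` — `x ∈ M, diag(s)·M ≤ M ⇒ diag(s)·x − s_j·x ∈ M`.
* **`smul_single_mem_of_mapGL_diagonal_le`** — TARGET A verbatim.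
HONEST LABEL.  Count-neutral; nothing printed is asserted; the census laws stay PROVER TARGETS; `HC_CM` is proved only modulo the 7 printed citations (2 remaining named inputs:
hLiu418 = `stmt-HodgeConjecture-24832`, h413 = `stmt-HodgeConjecture-24833`) until rung 0 closes.

## References
* [Kottwitz1986BaseChangeUnits] R. E. Kottwitz, *Base change for unit elements of Hecke algebras*, Compositio Math. 60 (1986), §1 pp. 240–241 (fixed lattices of a torus element).
* [Serre1980Trees] J.-P. Serre, *Trees*, Springer (1980), Ch. II §1.1 (lattices and the action of diagonal elements).
* [BruhatTits1972] F. Bruhat, J. Tits, *Groupes réductifs sur un corps local I*, Publ. Math. IHÉS 41 (1972), §10.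
-/

set_option autoImplicit false

noncomputable section

namespace Summit.HodgeConjecture.HodgeConjecture.Cruxes.H413.F0P3cDyRamDiagonalBigTube

open Matrix
open Literature.NumberTheory.Automorphic Literature.NumberTheory.Automorphic.HermitianLattice
open Literature.NumberTheory.Automorphic.UnitaryLatticeTree
open scoped Valued WithZero Matrix MatrixGroups

variable {K : Type*} [Field K] [Valued K ℤᵐ⁰] {N : ℕ}

omit [Valued K ℤᵐ⁰] in
/-- `diag(s)·x − s_j·x = ((s_l − s_j)·x_l)_l`. [cite: Serre1980Trees, II §1.1] -/
theorem diagonal_mulVec_sub_smul (s : Fin N → K) (j : Fin N) (x : Fin N → K) :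
    (Matrix.diagonal s).mulVec x - s j • x = fun l => (s l - s j) * x l := by
  funext l
  rw [Pi.sub_apply, Matrix.mulVec_diagonal, Pi.smul_apply, smul_eq_mul, sub_mul]

/-- If `diag(s)·M ≤ M` (`|s_j| ≤ 1`) then `x ∈ M ⇒ diag(s)·x − s_j·x ∈ M` (both summands are members). [cite: Kottwitz1986BaseChangeUnits, §1 pp. 240–241] -/
theorem diagonal_mulVec_sub_smul_mem (s : Fin N → K) {j : Fin N} (hsj : Valued.v (s j) ≤ 1) (T : GL (Fin N) K)
    (hT : (T : Matrix (Fin N) (Fin N) K) = Matrix.diagonal s) (M : Submodule 𝒪[K] (Fin N → K)) (hfix : mapGL T M ≤ M)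
    {x : Fin N → K} (hx : x ∈ M) : (Matrix.diagonal s).mulVec x - s j • x ∈ M := by
  refine M.sub_mem ?_ (M.smul_mem (⟨s j, hsj⟩ : 𝒪[K]) hx)
  have h := hfix (Submodule.mem_map.2 ⟨x, hx, rfl⟩)
  rwa [LinearMap.restrictScalars_apply, Matrix.toLin'_apply, hT] at h

/-- **«BIG-TUBE NECESSITY» (TARGET A).**  `T = diag(s)` with `|s_i| ≤ 1`, `M` a lattice with `diag(s)·M ≤ M`, `{i, j, k} = Fin 3`: for every `x ∈ M`,
`(s_i − s_j)(s_i − s_k)·x_i·e_i ∈ M` — apply `(diag(s) − s_j)` and `(diag(s) − s_k)` in turn; the product kills the `j`- and `k`-coordinates and scales the `i`-coordinate by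
`(s_i − s_j)(s_i − s_k)`.  In tree language: a fixed vertex has axis exponent `c_i(M) ≤ v(s_i − s_j) + v(s_i − s_k)` for every slot `i` (the explicit radius of the fixed set about the
`i`-th splitting sub-building). [cite: Kottwitz1986BaseChangeUnits, §1 pp. 240–241] [cite: Serre1980Trees, II §1.1] [cite: BruhatTits1972, §10] -/
theorem smul_single_mem_of_mapGL_diagonal_le {K : Type*} [Field K] [Valued K ℤᵐ⁰] (s : Fin 3 → K) (hs : ∀ i, Valued.v (s i) ≤ 1) (T : GL (Fin 3) K)
    (hT : (T : Matrix (Fin 3) (Fin 3) K) = Matrix.diagonal s) (M : Submodule 𝒪[K] (Fin 3 → K)) (hfix : mapGL T M ≤ M) {i j k : Fin 3} (hij : i ≠ j) (hik : i ≠ k)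
    (hjk : j ≠ k) : ∀ x ∈ M, ((s i - s j) * (s i - s k)) • (Pi.single i (x i) : Fin 3 → K) ∈ M := by
  intro x hx
  -- `y := diag(s)·x − s_j·x ∈ M`, then `diag(s)·y − s_k·y ∈ M`
  have hy := diagonal_mulVec_sub_smul_mem s (hs j) T hT M hfix hx
  have hz := diagonal_mulVec_sub_smul_mem s (hs k) T hT M hfix hy
  rw [diagonal_mulVec_sub_smul s j x, diagonal_mulVec_sub_smul s k] at hz
  -- the vector `((s_l − s_k)(s_l − s_j)·x_l)_l` is the claimed one: every `l` is `i`, `j` or `k`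
  have hcover : ∀ l : Fin 3, l = i ∨ l = j ∨ l = k := by intro l; omega
  have heq : (fun l => (s l - s k) * ((s l - s j) * x l)) = ((s i - s j) * (s i - s k)) • (Pi.single i (x i) : Fin 3 → K) := by
    funext l
    rw [Pi.smul_apply, smul_eq_mul]
    rcases hcover l with rfl | rfl | rfl
    · rw [Pi.single_eq_same]; ring
    · rw [Pi.single_eq_of_ne (Ne.symm hij), sub_self, zero_mul, mul_zero, mul_zero]
    · rw [Pi.single_eq_of_ne (Ne.symm hik), sub_self, zero_mul, mul_zero]
  rw [heq] at hz
  exact hz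

/-! ## ED. 2 (append-only): the same in ★ #0a H13 `AxisStable` currency — the explicit radius of the fixed set about the `i`-th splitting sub-building -/

/-- **BIG-TUBE NECESSITY IN AXIS-EXPONENT CURRENCY** (★ #0a H13 `AxisStable ϖ P Λ c := Λ.map (ϖ^c • P) ≤ Λ` with `P = E_ii = Matrix.single i i 1`, the coordinate idempotent of
the diagonal model): if `diag(s)·M ≤ M` (`|s_l| ≤ 1`), `{i, j, k} = Fin 3` and `|ϖ|^c ≤ |(s_i − s_j)(s_i − s_k)|` (i.e. `c ≥ v(s_i − s_j) + v(s_i − s_k)`), then `M` is `ϖ^c E_ii`-stable —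
«`c_i(M) ≤ v(s_i − s_j) + v(s_i − s_k)`», the mirror of the hypothesis shape of ★ p855052 `mapGL_eq_of_diagonal_of_axisStable` (tube ⊆ Fix ⊆ big tube).
[cite: Kottwitz1986BaseChangeUnits, §1 pp. 240–241] [cite: Serre1980Trees, II §1.1] [cite: BruhatTits1972, §10] -/
theorem map_smul_single_le_of_mapGL_diagonal_le {K : Type*} [Field K] [Valued K ℤᵐ⁰] {ϖ : K} (s : Fin 3 → K) (hs : ∀ i, Valued.v (s i) ≤ 1) (T : GL (Fin 3) K)
    (hT : (T : Matrix (Fin 3) (Fin 3) K) = Matrix.diagonal s) (M : Submodule 𝒪[K] (Fin 3 → K)) (hfix : mapGL T M ≤ M) {i j k : Fin 3} (hij : i ≠ j) (hik : i ≠ k)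
    (hjk : j ≠ k) {c : ℕ} (hc : Valued.v ϖ ^ c ≤ Valued.v ((s i - s j) * (s i - s k))) :
    M.map ((Matrix.toLin' (ϖ ^ c • Matrix.single i i (1 : K))).restrictScalars 𝒪[K]) ≤ M := by
  rw [Submodule.map_le_iff_le_comap]
  intro x hx
  rw [Submodule.mem_comap, LinearMap.restrictScalars_apply, Matrix.toLin'_apply, Matrix.smul_mulVec, Matrix.single_mulVec, one_mul]
  change ϖ ^ c • (Pi.single i (x i) : Fin 3 → K) ∈ M
  -- `(s_i − s_j)(s_i − s_k) ≠ 0` unless `ϖ^c = 0` (then the vector is `0 ∈ M`)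
  by_cases h0 : (ϖ ^ c : K) = 0
  · rw [h0, zero_smul]; exact M.zero_mem
  have hprod : (s i - s j) * (s i - s k) ≠ 0 := by
    intro h
    rw [h, map_zero, ← map_pow, le_zero_iff] at hc
    exact h0 ((Valuation.zero_iff _).1 hc)
  -- rescale TARGET A by the integer `ϖ^c ∕ ((s_i − s_j)(s_i − s_k))`
  have hq : Valued.v (ϖ ^ c / ((s i - s j) * (s i - s k))) ≤ 1 := by
    rw [map_div₀, map_pow, div_le_one₀ ((Valuation.pos_iff _).2 hprod)]
    exact hc
  have heq : ϖ ^ c • (Pi.single i (x i) : Fin 3 → K) = (ϖ ^ c / ((s i - s j) * (s i - s k))) • (((s i - s j) * (s i - s k)) • (Pi.single i (x i) : Fin 3 → K)) := by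
    rw [smul_smul, div_mul_cancel₀ _ hprod]
  rw [heq]
  exact M.smul_mem (⟨ϖ ^ c / ((s i - s j) * (s i - s k)), hq⟩ : 𝒪[K]) (smul_single_mem_of_mapGL_diagonal_le s hs T hT M hfix hij hik hjk x hx)

/-- The two-exponent form: `|ϖ|^{c_j} ≤ |s_i − s_j|` and `|ϖ|^{c_k} ≤ |s_i − s_k|` (`c_j ≥ v(s_i − s_j)`, `c_k ≥ v(s_i − s_k)`) give `ϖ^{c_j + c_k} E_ii`-stability of every
`diag(s)`-stable lattice — «`c_i(M) ≤ v(s_i − s_j) + v(s_i − s_k)`» (DATUM §5). [cite: Kottwitz1986BaseChangeUnits, §1 pp. 240–241] [cite: Serre1980Trees, II §1.1] -/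
theorem map_smul_single_le_of_mapGL_diagonal_le_add {K : Type*} [Field K] [Valued K ℤᵐ⁰] {ϖ : K} (s : Fin 3 → K) (hs : ∀ i, Valued.v (s i) ≤ 1) (T : GL (Fin 3) K)
    (hT : (T : Matrix (Fin 3) (Fin 3) K) = Matrix.diagonal s) (M : Submodule 𝒪[K] (Fin 3 → K)) (hfix : mapGL T M ≤ M) {i j k : Fin 3} (hij : i ≠ j) (hik : i ≠ k)
    (hjk : j ≠ k) {cj ck : ℕ} (hcj : Valued.v ϖ ^ cj ≤ Valued.v (s i - s j)) (hck : Valued.v ϖ ^ ck ≤ Valued.v (s i - s k)) :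
    M.map ((Matrix.toLin' (ϖ ^ (cj + ck) • Matrix.single i i (1 : K))).restrictScalars 𝒪[K]) ≤ M :=
  map_smul_single_le_of_mapGL_diagonal_le s hs T hT M hfix hij hik hjk (by rw [pow_add, map_mul]; exact mul_le_mul' hcj hck)

end Summit.HodgeConjecture.HodgeConjecture.Cruxes.H413.F0P3cDyRamDiagonalBigTube

end
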